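import Summits.QuantumFields.BalabanUV.T4Continuum.Support.ShellMeasureLinearChartMap

/-!
# `T4Continuum.ShellMeasureLinearChartBlock` — «WALL ROW R10 IN KERNEL — THE LINEAR CHART MAP», file 1b: THE DESIGNED INSTANCE —
# block coordinates regrouped per bond and read by a fibre coordinate map (`blockChart`), its pinned extension by zero
# (`pinChart`); operator norm `≤ ‖κ‖`, real points to real fields, block support; nonzero
(cell `pub-balaban`, sub-cell `t4`, spine estimate NE7c (node U5b); NE7c ROUND-2 crew, unit `b2b-balaban-t4-ne7c-formalise-leaf-10`
gen 13; owner table `t4/b2b-balaban-t4-ne7c-p1/LEAVES-NE7c-P1.md` row **S104** «WALL ROW R10 IN KERNEL — THE LINEAR CHART MAP»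
(OFFER O-ne7cL10g13-1 journal l.20903, owner GO R-ne7cp1-g36-2 l.21166), file 1b of 3; v1.1 = v1 (p236936) + §4 APPENDED (owner FINDING
F-ne7cp1-g36-1, journal l.21316; v1's declarations byte-identical); ADDITIVE — imports file 1a `ShellMeasureLinearChartMap` ONLY;
[folklore]; 5 data `def`s (`coordL`, `blockChart`, `pinChart`, `blockChartFam`, `pinChartFam` — continuous linear maps, no estimate, no
`Prop`), 0 `def … : Prop`, 0 sorry, 0 citation tags)

HONEST FRAMING.  Finite four-torus programme, rung (B)+1 only — NOT infinite volume, NOT a mass gap, NOT the Clay problem, NOT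
summit progress; (B), `BetaPertHyp`, (B^μ) not consumed.  NE7c (`T4IndicatorShell.ShellWeightBound` for the cell's expansions) is
NOT PRINTED in [Balaban 1983–89] and NOT PROVED; «NE7c ⇐ the named binders» (trigger c3).  This file is LINEAR ALGEBRA ON OUR OWN
CHART: nothing of Bałaban's is asserted, cited or discharged.  HONEST DEPENDENCY (cell): continuum YM on T⁴ ⇐ BetaPertH ∧ nine
spine estimates (0/9 proved); BetaPertH ⇐ (D1) ∧ (D4) ∧ CAP+tail; G-an2-4 gates asym, D1 and NE2/3/4.

THE POINT.  File 1a proves that the END hosts' nine `Φ`-binders (census row R10) are free for ANY continuous linear chart map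
`T V` under ONE number relation `‖T V‖·r_Φ < b`.  This file records the map the chart DESIGNS (READING of [Balaban1985Variational]
p. 284 (42) ∕ p. 289 (75) ∕ Sect. G p. 305 (172)–(174) ∕ Prop. 9 p. 309 «`B = (1∕i) log V′`», `V = V′V₀`: the datum `B` is the bondwise
logarithm of the coarse field relative to the centre — in the exponential chart `T4CubeChartExp.expFibreChart Λ c e`, `x ↦ (b ↦ c_b·exp(ι x_{e(b,·)}))`, that is the chart coordinate
regrouped per bond and read by the fibre's coordinate map; a locator, NOT a citation): `blockChart e κ : z ↦ (b ↦ κ (z ∘ e(b,·)))` for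
a fibre coordinate map `κ : (Fin 3 → ℂ) →L[ℂ] 𝔇` (for `SU(2)`: `v ↦ Σ_a v_a τ_a`; the identification of `𝔇` with the END's abstract
fibre is node O's, as everywhere), and its pinned version `pinChart e κ incl` on a larger index set `Λb` (the w-tuple's flat pi-type),
zero off the block.  The numbers the relation asks for: `‖blockChart e κ‖ ≤ ‖κ‖`, `‖pinChart e κ incl‖ ≤ ‖κ‖`.
* §1 `coordL e b` (the three coordinates of bond `b`; `‖·‖ ≤ 1`; real on real points), **`blockChart`**, `norm_blockChart_le`,
  **`blockChart_cplx_mem`** (real chart points go to `AddSubgroup.pi univ 𝓡𝔇` when `κ` sends real triples into `𝓡𝔇` — the END's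
  `hΦr` shape with no window restriction).
* §2 **`pinChart`** (`Function.extend` by zero along `incl : α → Λb`), `pinChart_apply_incl`, `pinChart_apply_of_not_mem_range`,
  `norm_pinChart_le`, **`pinChart_supp`** (the END's `hsupp` row from «positive pin depth ⟹ off the block»), `pinChart_cplx_mem`.
* §3 NON-VACUITY: `blockChart_ne_zero` (nonempty block, `κ ≠ 0`) and a concrete `example` (`κ := id`, real triples = real parts)
  inhabiting `‖T‖ ≤ ‖κ‖`, the reality hypothesis and `T ≠ 0` jointly (crew rule G-1).
* §4 (v1.1, owner FINDING F-ne7cp1-g36-1 «THE DESIGNED INSTANCE IS BONDWISE Ad-TWISTED») THE BOND-INDEXED FIBRE MAPS: at a general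
  centre `c = V₀` the left-relative variable `V′_b = c_b·exp(ιy_b)·c_b⁻¹ = exp(Ad(c_b)(ιy_b))` reads bond `b` through `κ_b = Ad(c_b) ∘ κ`;
  **`blockChartFam e κ`** ∕ **`pinChartFam e κ incl`** for `κ : α → ((Fin 3 → ℂ) →L[ℂ] 𝔇)` with `‖·‖ ≤ K` from `∀ b, ‖κ b‖ ≤ K`
  (`norm_blockChartFam_le`, `norm_pinChartFam_le`), reality under `∀ b` (`blockChartFam_cplx_mem`, `pinChartFam_cplx_mem`), block support
  (`pinChartFam_supp`), `blockChartFam_ne_zero`; §1–§2 ARE the constant family (`blockChart_eq_fam`, `pinChart_eq_fam`, `rfl`); the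
  Ad-twist by linear isometries costs nothing: `norm_blockChartFam_twist_le` (`‖blockChartFam e (fun b => R b ∘ κ)‖ ≤ ‖κ‖`).  The `SO(3)`
  identity `c·exp(ιv)·c⁻¹ = exp(ι(R_c v))` on `expPoint` is node O's [dict] sentence, NOT typed here.
NOTHING in the countdown moves; NE7c NOT PROVED; spine PROVED 0∕9.
-/

noncomputable section

open Set Metric

namespace Summit.QuantumFields.BalabanUV.T4Continuum.ShellMeasureLinearChartBlock

open ShellMeasureLandauHolonomyChart (cplx)

/-! ## §1 The designed instance: block coordinates regrouped per bond and read by a fibre coordinate map -/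

section Block

variable {m : ℕ} {α : Type*} {𝔇 : Type*} [NormedAddCommGroup 𝔇] [NormedSpace ℂ 𝔇]

/-- the three (complexified) coordinates of the block bond `b`: `z ↦ (i ↦ z (e (b, i)))`, a CLM. [folklore] -/
def coordL (e : α × Fin 3 ≃ Fin m) (b : α) : (Fin m → ℂ) →L[ℂ] (Fin 3 → ℂ) :=
  ContinuousLinearMap.pi fun i => ContinuousLinearMap.proj (e (b, i))

/-- `coordL e b z i = z (e (b, i))`. [folklore] -/
@[simp] theorem coordL_apply (e : α × Fin 3 ≃ Fin m) (b : α) (z : Fin m → ℂ) (i : Fin 3) :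
    coordL e b z i = z (e (b, i)) := rfl

/-- `‖coordL e b z‖ ≤ ‖z‖` (sup norms). [folklore] -/
theorem norm_coordL_apply_le (e : α × Fin 3 ≃ Fin m) (b : α) (z : Fin m → ℂ) : ‖coordL e b z‖ ≤ ‖z‖ :=
  (pi_norm_le_iff_of_nonneg (norm_nonneg z)).2 fun i => by
    rw [coordL_apply]; exact norm_le_pi_norm z _

/-- `‖coordL e b‖ ≤ 1`. [folklore] -/
theorem norm_coordL_le (e : α × Fin 3 ≃ Fin m) (b : α) : ‖coordL e b‖ ≤ 1 :=
  ContinuousLinearMap.opNorm_le_bound _ zero_le_one fun z => by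
    rw [one_mul]; exact norm_coordL_apply_le e b z

/-- on a real point the bond coordinates are real: `coordL e b (cplx y) = cplx (y ∘ e(b,·))`. [folklore] -/
theorem coordL_cplx (e : α × Fin 3 ≃ Fin m) (b : α) (y : Fin m → ℝ) :
    coordL e b (cplx y) = cplx (fun i => y (e (b, i))) := by
  funext i; rfl

/-- **THE DESIGNED LINEAR CHART MAP OF THE BLOCK**: `z ↦ (b ↦ κ (z ∘ e(b,·)))` — block coordinates regrouped per bond and read by
the fibre coordinate map `κ : (Fin 3 → ℂ) →L[ℂ] 𝔇` (for `SU(2)`: `v ↦ Σ_a v_a τ_a`). [folklore] -/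
def blockChart (e : α × Fin 3 ≃ Fin m) (κ : (Fin 3 → ℂ) →L[ℂ] 𝔇) : (Fin m → ℂ) →L[ℂ] (α → 𝔇) :=
  ContinuousLinearMap.pi fun b => κ.comp (coordL e b)

/-- `blockChart e κ z b = κ (coordL e b z)`. [folklore] -/
@[simp] theorem blockChart_apply (e : α × Fin 3 ≃ Fin m) (κ : (Fin 3 → ℂ) →L[ℂ] 𝔇) (z : Fin m → ℂ) (b : α) :
    blockChart e κ z b = κ (coordL e b z) := rfl

variable [Fintype α]

/-- `‖blockChart e κ z‖ ≤ ‖κ‖·‖z‖`. [folklore] -/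
theorem norm_blockChart_apply_le (e : α × Fin 3 ≃ Fin m) (κ : (Fin 3 → ℂ) →L[ℂ] 𝔇) (z : Fin m → ℂ) :
    ‖blockChart e κ z‖ ≤ ‖κ‖ * ‖z‖ :=
  (pi_norm_le_iff_of_nonneg (mul_nonneg (norm_nonneg κ) (norm_nonneg z))).2 fun b => by
    rw [blockChart_apply]
    exact (κ.le_opNorm _).trans (mul_le_mul_of_nonneg_left (norm_coordL_apply_le e b z) (norm_nonneg κ))

/-- **`‖blockChart e κ‖ ≤ ‖κ‖`** — the only number the R10 relation `‖T‖·r_Φ < b` asks of the designed map. [folklore] -/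
theorem norm_blockChart_le (e : α × Fin 3 ≃ Fin m) (κ : (Fin 3 → ℂ) →L[ℂ] 𝔇) : ‖blockChart e κ‖ ≤ ‖κ‖ :=
  ContinuousLinearMap.opNorm_le_bound _ (norm_nonneg κ) (norm_blockChart_apply_le e κ)

omit [Fintype α] in
/-- **REAL POINTS GO TO REAL FIELDS**: if the fibre coordinate map sends real triples into the additive subgroup `𝓡𝔇` (for `SU(2)`:
the skew-adjoint matrices), the designed chart map sends every real chart point into `AddSubgroup.pi univ 𝓡𝔇` — the shape of
the END hosts' `hΦr`∕`hΦrw`, with no window restriction. [folklore] -/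
theorem blockChart_cplx_mem (e : α × Fin 3 ≃ Fin m) (κ : (Fin 3 → ℂ) →L[ℂ] 𝔇) (𝓡𝔇 : AddSubgroup 𝔇)
    (hκr : ∀ v : Fin 3 → ℝ, κ (cplx v) ∈ 𝓡𝔇) (y : Fin m → ℝ) :
    blockChart e κ (cplx y) ∈ AddSubgroup.pi Set.univ (fun _ : α => 𝓡𝔇) := by
  refine (AddSubgroup.mem_pi _).2 fun b _ => ?_
  rw [blockChart_apply, coordL_cplx]
  exact hκr _

end Block

/-! ## §2 The pinned instance: the block chart placed in a larger index set, zero off the block -/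

section Pin

variable {m : ℕ} {α Λb : Type*} {𝔇 : Type*} [NormedAddCommGroup 𝔇] [NormedSpace ℂ 𝔇]

/-- **THE PINNED LINEAR CHART MAP**: along an injection `incl : α → Λb` of the block bonds into the pinned index set, the bond
`incl b` reads `κ (z ∘ e(b,·))` and every other index reads `0` (extension by zero, `Function.extend`). [folklore] -/
def pinChart (e : α × Fin 3 ≃ Fin m) (κ : (Fin 3 → ℂ) →L[ℂ] 𝔇) (incl : α → Λb) : (Fin m → ℂ) →L[ℂ] (Λb → 𝔇) :=
  ContinuousLinearMap.pi (Function.extend incl (fun b => κ.comp (coordL e b)) 0)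

/-- `pinChart e κ incl z i = (Function.extend incl (fun b => κ.comp (coordL e b)) 0 i) z`. [folklore] -/
theorem pinChart_apply (e : α × Fin 3 ≃ Fin m) (κ : (Fin 3 → ℂ) →L[ℂ] 𝔇) (incl : α → Λb) (z : Fin m → ℂ) (i : Λb) :
    pinChart e κ incl z i = (Function.extend incl (fun b => κ.comp (coordL e b)) 0 i) z := rfl

/-- ON the block: `pinChart e κ incl z (incl b) = κ (coordL e b z)` (`incl` injective). [folklore] -/
theorem pinChart_apply_incl (e : α × Fin 3 ≃ Fin m) (κ : (Fin 3 → ℂ) →L[ℂ] 𝔇) {incl : α → Λb}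
    (hincl : Function.Injective incl) (z : Fin m → ℂ) (b : α) :
    pinChart e κ incl z (incl b) = κ (coordL e b z) := by
  rw [pinChart_apply, hincl.extend_apply]; rfl

/-- OFF the block: `pinChart e κ incl z i = 0` for `i ∉ range incl`. [folklore] -/
theorem pinChart_apply_of_not_mem_range (e : α × Fin 3 ≃ Fin m) (κ : (Fin 3 → ℂ) →L[ℂ] 𝔇) (incl : α → Λb)
    (z : Fin m → ℂ) {i : Λb} (hi : i ∉ Set.range incl) : pinChart e κ incl z i = 0 := by
  rw [pinChart_apply, Function.extend_apply' _ _ _ fun ⟨b, hb⟩ => hi ⟨b, hb⟩]; rfl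

/-- pointwise: every pinned coordinate is bounded by `‖κ‖·‖z‖`. [folklore] -/
theorem norm_pinChart_apply_apply_le (e : α × Fin 3 ≃ Fin m) (κ : (Fin 3 → ℂ) →L[ℂ] 𝔇) {incl : α → Λb}
    (hincl : Function.Injective incl) (z : Fin m → ℂ) (i : Λb) : ‖pinChart e κ incl z i‖ ≤ ‖κ‖ * ‖z‖ := by
  by_cases hi : i ∈ Set.range incl
  · obtain ⟨b, rfl⟩ := hi
    rw [pinChart_apply_incl e κ hincl]
    exact (κ.le_opNorm _).trans (mul_le_mul_of_nonneg_left (norm_coordL_apply_le e b z) (norm_nonneg κ))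
  · rw [pinChart_apply_of_not_mem_range e κ incl z hi, norm_zero]
    exact mul_nonneg (norm_nonneg κ) (norm_nonneg z)

variable [Fintype Λb]

/-- `‖pinChart e κ incl z‖ ≤ ‖κ‖·‖z‖`. [folklore] -/
theorem norm_pinChart_apply_le (e : α × Fin 3 ≃ Fin m) (κ : (Fin 3 → ℂ) →L[ℂ] 𝔇) {incl : α → Λb}
    (hincl : Function.Injective incl) (z : Fin m → ℂ) : ‖pinChart e κ incl z‖ ≤ ‖κ‖ * ‖z‖ :=
  (pi_norm_le_iff_of_nonneg (mul_nonneg (norm_nonneg κ) (norm_nonneg z))).2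
    (norm_pinChart_apply_apply_le e κ hincl z)

/-- **`‖pinChart e κ incl‖ ≤ ‖κ‖`**. [folklore] -/
theorem norm_pinChart_le (e : α × Fin 3 ≃ Fin m) (κ : (Fin 3 → ℂ) →L[ℂ] 𝔇) {incl : α → Λb}
    (hincl : Function.Injective incl) : ‖pinChart e κ incl‖ ≤ ‖κ‖ :=
  ContinuousLinearMap.opNorm_le_bound _ (norm_nonneg κ) (norm_pinChart_apply_le e κ hincl)

omit [Fintype Λb] in
/-- **THE END's BLOCK-SUPPORT ROW `hsupp`** for the pinned chart map: if every index of positive pin depth lies OFF the block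
(`0 < ϖw (posb i) ⟹ i ∉ range incl` — the block sits at pin depth `0`), then `0 < ϖw (posb i) ⟹ pinChart … z i = 0` for every
section `V` and every `z`. [folklore] -/
theorem pinChart_supp {𝔙 𝔖 : Type*} (e : α × Fin 3 ≃ Fin m) (κ : (Fin 3 → ℂ) →L[ℂ] 𝔇) (incl : α → Λb)
    (ϖw : 𝔖 → ℝ) (posb : Λb → 𝔖) (hpin : ∀ i, 0 < ϖw (posb i) → i ∉ Set.range incl) :
    ∀ _V : 𝔙, ∀ z : Fin m → ℂ, ∀ i, 0 < ϖw (posb i) → pinChart e κ incl z i = 0 :=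
  fun _ z _ hi => pinChart_apply_of_not_mem_range e κ incl z (hpin _ hi)

omit [Fintype Λb] in
/-- real points go to `AddSubgroup.pi univ 𝓡𝔇` under the pinned chart map (`0 ∈ 𝓡𝔇` off the block). [folklore] -/
theorem pinChart_cplx_mem (e : α × Fin 3 ≃ Fin m) (κ : (Fin 3 → ℂ) →L[ℂ] 𝔇) {incl : α → Λb}
    (hincl : Function.Injective incl) (𝓡𝔇 : AddSubgroup 𝔇) (hκr : ∀ v : Fin 3 → ℝ, κ (cplx v) ∈ 𝓡𝔇) (y : Fin m → ℝ) :
    pinChart e κ incl (cplx y) ∈ AddSubgroup.pi Set.univ (fun _ : Λb => 𝓡𝔇) := by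
  refine (AddSubgroup.mem_pi _).2 fun i _ => ?_
  by_cases hi : i ∈ Set.range incl
  · obtain ⟨b, rfl⟩ := hi
    rw [pinChart_apply_incl e κ hincl, coordL_cplx]
    exact hκr _
  · rw [pinChart_apply_of_not_mem_range e κ incl _ hi]
    exact zero_mem _

end Pin

/-! ## §3 Non-vacuity (crew rule G-1) -/

section NonVacuity

variable {m : ℕ} {α 𝔇 : Type*} [NormedAddCommGroup 𝔇] [NormedSpace ℂ 𝔇]

/-- **THE DESIGNED MAP IS NONZERO** for a nonempty block and a nonzero fibre coordinate map. [folklore] -/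
theorem blockChart_ne_zero [Nonempty α] (e : α × Fin 3 ≃ Fin m) {κ : (Fin 3 → ℂ) →L[ℂ] 𝔇} (hκ : κ ≠ 0) :
    blockChart e κ ≠ 0 := by
  obtain ⟨v, hv⟩ : ∃ v, κ v ≠ 0 := by
    by_contra h; push Not at h; exact hκ (ContinuousLinearMap.ext fun v => by rw [h v]; rfl)
  obtain ⟨b⟩ := ‹Nonempty α›
  intro h0
  -- feed the coordinates `v` into bond `b`: `z (e (b, i)) := v i`
  set z : Fin m → ℂ := fun k => v (e.symm k).2 with hz
  have hcoord : coordL e b z = v := by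
    funext i; rw [coordL_apply, hz]; simp
  have := congrArg (fun T : (Fin m → ℂ) →L[ℂ] (α → 𝔇) => T z b) h0
  simp only [blockChart_apply, hcoord, zero_apply, Pi.zero_apply] at this
  exact hv this

/-- CONCRETE: on `Fin 3 → ℂ` itself (`κ := id`, real triples = vanishing imaginary parts) every hypothesis of §2 is met and the
map is nonzero — the shapes `‖T‖ ≤ ‖κ‖`, `hκr`, `T ≠ 0` are jointly inhabited. [folklore] -/
example (e : α × Fin 3 ≃ Fin m) [Fintype α] [Nonempty α] :
    let κ := ContinuousLinearMap.id ℂ (Fin 3 → ℂ)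
    let 𝓡 : AddSubgroup (Fin 3 → ℂ) := AddSubgroup.pi Set.univ fun _ => Complex.ofRealHom.toAddMonoidHom.range
    ‖blockChart e κ‖ ≤ ‖κ‖ ∧ (∀ v : Fin 3 → ℝ, κ (cplx v) ∈ 𝓡) ∧ blockChart e κ ≠ 0 := by
  refine ⟨norm_blockChart_le e _, fun v => (AddSubgroup.mem_pi _).2 fun i _ => ⟨v i, rfl⟩, blockChart_ne_zero e ?_⟩
  intro h
  have := congrArg (fun T : (Fin 3 → ℂ) →L[ℂ] (Fin 3 → ℂ) => T (fun _ => 1) 0) h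
  simp at this

end NonVacuity

/-! ## §4 (v1.1, owner F-ne7cp1-g36-1 «THE DESIGNED INSTANCE IS BONDWISE Ad-TWISTED») Bond-indexed fibre maps

The tree's block chart is LEFT-centred (`T4CubeChartExp.expFibreChart s c e x b = c b * expPt (x ∘ e(b,·))`) while print's relative
variable is the LEFT factor ([Balaban1985Variational] Prop. 9 p. 309: `U_k(V) = U_k(V′V₀)`, `B = (1∕i) log V′` — a READING, nothing
asserted).  At the centre `c = V₀`: `V′_b = c_b·exp(ιy_b)·c_b⁻¹ = exp(Ad(c_b)(ιy_b))`, so the designed datum map reads the coordinates of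
bond `b` through a BOND-DEPENDENT fibre map `κ_b = Ad(c_b) ∘ κ` (an isometry per bond for a unitary centre).  §1–§3's single-`κ` maps are
the case `c ≡ 1` — the centre of the END hosts of record (`expFibreChart Λ 1 e`, comb fixed to `1`) and of the S88∕S96 toys.  This
section carries the same facts for a bond-indexed family `κ : α → ((Fin 3 → ℂ) →L[ℂ] 𝔇)` under a uniform bound `‖κ b‖ ≤ K`; §1–§3 are
LITERALLY the special case `fun _ => κ` (`blockChart_eq_fam`, `pinChart_eq_fam`, by `rfl`).  The `SO(3)` identity
`c·exp(ιv)·c⁻¹ = exp(ι(R_c v))` on `expPoint` is node O's [dict] sentence and is NOT typed here. -/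

section Fam

variable {m : ℕ} {α Λb : Type*} {𝔇 : Type*} [NormedAddCommGroup 𝔇] [NormedSpace ℂ 𝔇]

/-- **THE BOND-INDEXED LINEAR CHART MAP**: `z ↦ (b ↦ κ b (z ∘ e(b,·)))` for a family of fibre coordinate maps `κ b` (designed:
`κ b = Ad(c_b) ∘ κ`). [folklore] -/
def blockChartFam (e : α × Fin 3 ≃ Fin m) (κ : α → ((Fin 3 → ℂ) →L[ℂ] 𝔇)) : (Fin m → ℂ) →L[ℂ] (α → 𝔇) :=
  ContinuousLinearMap.pi fun b => (κ b).comp (coordL e b)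

/-- `blockChartFam e κ z b = κ b (coordL e b z)`. [folklore] -/
@[simp] theorem blockChartFam_apply (e : α × Fin 3 ≃ Fin m) (κ : α → ((Fin 3 → ℂ) →L[ℂ] 𝔇)) (z : Fin m → ℂ) (b : α) :
    blockChartFam e κ z b = κ b (coordL e b z) := rfl

/-- §1's single-`κ` map IS the constant family. [folklore] -/
theorem blockChart_eq_fam (e : α × Fin 3 ≃ Fin m) (κ : (Fin 3 → ℂ) →L[ℂ] 𝔇) :
    blockChart e κ = blockChartFam e (fun _ => κ) := rfl

/-- pointwise: `‖blockChartFam e κ z b‖ ≤ K·‖z‖` under `‖κ b‖ ≤ K`. [folklore] -/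
theorem norm_blockChartFam_apply_apply_le (e : α × Fin 3 ≃ Fin m) {κ : α → ((Fin 3 → ℂ) →L[ℂ] 𝔇)} {K : ℝ}
    (hκ : ∀ b, ‖κ b‖ ≤ K) (z : Fin m → ℂ) (b : α) : ‖blockChartFam e κ z b‖ ≤ K * ‖z‖ := by
  rw [blockChartFam_apply]
  exact ((κ b).le_opNorm _).trans
    (mul_le_mul (hκ b) (norm_coordL_apply_le e b z) (norm_nonneg _) ((norm_nonneg _).trans (hκ b)))

variable [Fintype α]

/-- `‖blockChartFam e κ z‖ ≤ K·‖z‖` under `∀ b, ‖κ b‖ ≤ K`, `0 ≤ K`. [folklore] -/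
theorem norm_blockChartFam_apply_le (e : α × Fin 3 ≃ Fin m) {κ : α → ((Fin 3 → ℂ) →L[ℂ] 𝔇)} {K : ℝ}
    (hκ : ∀ b, ‖κ b‖ ≤ K) (hK : 0 ≤ K) (z : Fin m → ℂ) : ‖blockChartFam e κ z‖ ≤ K * ‖z‖ :=
  (pi_norm_le_iff_of_nonneg (mul_nonneg hK (norm_nonneg z))).2 (norm_blockChartFam_apply_apply_le e hκ z)

/-- **`‖blockChartFam e κ‖ ≤ K`** under `∀ b, ‖κ b‖ ≤ K`, `0 ≤ K` (for the designed `κ b = Ad(c_b) ∘ κ` with unitary `c_b`: `K = ‖κ‖`).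
[folklore] -/
theorem norm_blockChartFam_le (e : α × Fin 3 ≃ Fin m) {κ : α → ((Fin 3 → ℂ) →L[ℂ] 𝔇)} {K : ℝ}
    (hκ : ∀ b, ‖κ b‖ ≤ K) (hK : 0 ≤ K) : ‖blockChartFam e κ‖ ≤ K :=
  ContinuousLinearMap.opNorm_le_bound _ hK (norm_blockChartFam_apply_le e hκ hK)

omit [Fintype α] in
/-- real points go to `AddSubgroup.pi univ 𝓡𝔇` when EVERY `κ b` sends real triples into `𝓡𝔇`. [folklore] -/
theorem blockChartFam_cplx_mem (e : α × Fin 3 ≃ Fin m) (κ : α → ((Fin 3 → ℂ) →L[ℂ] 𝔇)) (𝓡𝔇 : AddSubgroup 𝔇)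
    (hκr : ∀ b (v : Fin 3 → ℝ), κ b (cplx v) ∈ 𝓡𝔇) (y : Fin m → ℝ) :
    blockChartFam e κ (cplx y) ∈ AddSubgroup.pi Set.univ (fun _ : α => 𝓡𝔇) := by
  refine (AddSubgroup.mem_pi _).2 fun b _ => ?_
  rw [blockChartFam_apply, coordL_cplx]
  exact hκr b _

omit [Fintype α] in
/-- the bond-indexed map is NONZERO as soon as ONE bond's fibre map is. [folklore] -/
theorem blockChartFam_ne_zero (e : α × Fin 3 ≃ Fin m) {κ : α → ((Fin 3 → ℂ) →L[ℂ] 𝔇)} {b : α} (hκ : κ b ≠ 0) :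
    blockChartFam e κ ≠ 0 := by
  obtain ⟨v, hv⟩ : ∃ v, κ b v ≠ 0 := by
    by_contra h; push Not at h; exact hκ (ContinuousLinearMap.ext fun v => by rw [h v]; rfl)
  intro h0
  set z : Fin m → ℂ := fun k => v (e.symm k).2 with hz
  have hcoord : coordL e b z = v := by
    funext i; rw [coordL_apply, hz]; simp
  have := congrArg (fun T : (Fin m → ℂ) →L[ℂ] (α → 𝔇) => T z b) h0
  simp only [blockChartFam_apply, hcoord, zero_apply, Pi.zero_apply] at this
  exact hv this

/-- **THE BOND-INDEXED PINNED CHART MAP**: `blockChartFam` placed along `incl : α → Λb`, zero elsewhere. [folklore] -/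
def pinChartFam (e : α × Fin 3 ≃ Fin m) (κ : α → ((Fin 3 → ℂ) →L[ℂ] 𝔇)) (incl : α → Λb) :
    (Fin m → ℂ) →L[ℂ] (Λb → 𝔇) :=
  ContinuousLinearMap.pi (Function.extend incl (fun b => (κ b).comp (coordL e b)) 0)

omit [Fintype α] in
/-- §2's single-`κ` pinned map IS the constant family. [folklore] -/
theorem pinChart_eq_fam (e : α × Fin 3 ≃ Fin m) (κ : (Fin 3 → ℂ) →L[ℂ] 𝔇) (incl : α → Λb) :
    pinChart e κ incl = pinChartFam e (fun _ => κ) incl := rfl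

omit [Fintype α] in
/-- `pinChartFam e κ incl z i = (Function.extend incl (fun b => (κ b).comp (coordL e b)) 0 i) z`. [folklore] -/
theorem pinChartFam_apply (e : α × Fin 3 ≃ Fin m) (κ : α → ((Fin 3 → ℂ) →L[ℂ] 𝔇)) (incl : α → Λb) (z : Fin m → ℂ)
    (i : Λb) : pinChartFam e κ incl z i = (Function.extend incl (fun b => (κ b).comp (coordL e b)) 0 i) z := rfl

omit [Fintype α] in
/-- ON the block: `pinChartFam e κ incl z (incl b) = κ b (coordL e b z)` (`incl` injective). [folklore] -/
theorem pinChartFam_apply_incl (e : α × Fin 3 ≃ Fin m) (κ : α → ((Fin 3 → ℂ) →L[ℂ] 𝔇)) {incl : α → Λb}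
    (hincl : Function.Injective incl) (z : Fin m → ℂ) (b : α) :
    pinChartFam e κ incl z (incl b) = κ b (coordL e b z) := by
  rw [pinChartFam_apply, hincl.extend_apply]; rfl

omit [Fintype α] in
/-- OFF the block: `pinChartFam e κ incl z i = 0` for `i ∉ range incl`. [folklore] -/
theorem pinChartFam_apply_of_not_mem_range (e : α × Fin 3 ≃ Fin m) (κ : α → ((Fin 3 → ℂ) →L[ℂ] 𝔇)) (incl : α → Λb)
    (z : Fin m → ℂ) {i : Λb} (hi : i ∉ Set.range incl) : pinChartFam e κ incl z i = 0 := by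
  rw [pinChartFam_apply, Function.extend_apply' _ _ _ fun ⟨b, hb⟩ => hi ⟨b, hb⟩]; rfl

omit [Fintype α] in
/-- pointwise: every pinned coordinate is bounded by `K·‖z‖` under `∀ b, ‖κ b‖ ≤ K`, `0 ≤ K`. [folklore] -/
theorem norm_pinChartFam_apply_apply_le (e : α × Fin 3 ≃ Fin m) {κ : α → ((Fin 3 → ℂ) →L[ℂ] 𝔇)} {K : ℝ}
    (hκ : ∀ b, ‖κ b‖ ≤ K) (hK : 0 ≤ K) {incl : α → Λb} (hincl : Function.Injective incl) (z : Fin m → ℂ) (i : Λb) :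
    ‖pinChartFam e κ incl z i‖ ≤ K * ‖z‖ := by
  by_cases hi : i ∈ Set.range incl
  · obtain ⟨b, rfl⟩ := hi
    rw [pinChartFam_apply_incl e κ hincl]
    exact ((κ b).le_opNorm _).trans
      (mul_le_mul (hκ b) (norm_coordL_apply_le e b z) (norm_nonneg _) ((norm_nonneg _).trans (hκ b)))
  · rw [pinChartFam_apply_of_not_mem_range e κ incl z hi, norm_zero]
    exact mul_nonneg hK (norm_nonneg z)

omit [Fintype α] in
/-- **`‖pinChartFam e κ incl‖ ≤ K`** under `∀ b, ‖κ b‖ ≤ K`, `0 ≤ K`. [folklore] -/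
theorem norm_pinChartFam_le [Fintype Λb] (e : α × Fin 3 ≃ Fin m) {κ : α → ((Fin 3 → ℂ) →L[ℂ] 𝔇)} {K : ℝ}
    (hκ : ∀ b, ‖κ b‖ ≤ K) (hK : 0 ≤ K) {incl : α → Λb} (hincl : Function.Injective incl) : ‖pinChartFam e κ incl‖ ≤ K :=
  ContinuousLinearMap.opNorm_le_bound _ hK fun z =>
    (pi_norm_le_iff_of_nonneg (mul_nonneg hK (norm_nonneg z))).2 (norm_pinChartFam_apply_apply_le e hκ hK hincl z)

omit [Fintype α] in
/-- **THE END's BLOCK-SUPPORT ROW `hsupp`** for the bond-indexed pinned chart map («positive pin depth ⟹ off the block»). [folklore] -/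
theorem pinChartFam_supp {𝔙 𝔖 : Type*} (e : α × Fin 3 ≃ Fin m) (κ : α → ((Fin 3 → ℂ) →L[ℂ] 𝔇)) (incl : α → Λb)
    (ϖw : 𝔖 → ℝ) (posb : Λb → 𝔖) (hpin : ∀ i, 0 < ϖw (posb i) → i ∉ Set.range incl) :
    ∀ _V : 𝔙, ∀ z : Fin m → ℂ, ∀ i, 0 < ϖw (posb i) → pinChartFam e κ incl z i = 0 :=
  fun _ z _ hi => pinChartFam_apply_of_not_mem_range e κ incl z (hpin _ hi)

omit [Fintype α] in
/-- real points go to `AddSubgroup.pi univ 𝓡𝔇` under the bond-indexed pinned chart map. [folklore] -/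
theorem pinChartFam_cplx_mem (e : α × Fin 3 ≃ Fin m) (κ : α → ((Fin 3 → ℂ) →L[ℂ] 𝔇)) {incl : α → Λb}
    (hincl : Function.Injective incl) (𝓡𝔇 : AddSubgroup 𝔇) (hκr : ∀ b (v : Fin 3 → ℝ), κ b (cplx v) ∈ 𝓡𝔇)
    (y : Fin m → ℝ) : pinChartFam e κ incl (cplx y) ∈ AddSubgroup.pi Set.univ (fun _ : Λb => 𝓡𝔇) := by
  refine (AddSubgroup.mem_pi _).2 fun i _ => ?_
  by_cases hi : i ∈ Set.range incl
  · obtain ⟨b, rfl⟩ := hi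
    rw [pinChartFam_apply_incl e κ hincl, coordL_cplx]
    exact hκr b _
  · rw [pinChartFam_apply_of_not_mem_range e κ incl _ hi]
    exact zero_mem _

/-- **THE Ad-TWISTED INSTANCE** (the shape the designed map has at a unitary centre): for a family of linear ISOMETRIES `R b` of the
fibre (designed: `Ad(c_b)`), the twisted family `κ b := (R b) ∘ κ` has `‖κ b‖ ≤ ‖κ‖` for every bond, so `‖blockChartFam e κ‖ ≤ ‖κ‖`
— the SAME number the untwisted map gives (`norm_blockChart_le`). [folklore] -/
theorem norm_blockChartFam_twist_le (e : α × Fin 3 ≃ Fin m) (κ : (Fin 3 → ℂ) →L[ℂ] 𝔇) (R : α → (𝔇 →ₗᵢ[ℂ] 𝔇)) :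
    ‖blockChartFam e (fun b => (R b).toContinuousLinearMap.comp κ)‖ ≤ ‖κ‖ :=
  norm_blockChartFam_le e (fun b => by
    refine ContinuousLinearMap.opNorm_le_bound _ (norm_nonneg κ) fun v => ?_
    rw [ContinuousLinearMap.comp_apply, LinearIsometry.coe_toContinuousLinearMap, LinearIsometry.norm_map]
    exact κ.le_opNorm v) (norm_nonneg κ)

end Fam

end Summit.QuantumFields.BalabanUV.T4Continuum.ShellMeasureLinearChartBlock
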